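import Summits.CriticalPhenomena.PercolationContinuityZ3.Theorems.PercNearOneGluingNoHeavyQuantOneArmOfThetaDKT
import HarnessLib

/-!
# PAPER-2 track, ARM-3 gen 3: `ThetaModulusNearCritical d ω ⇒ OneArmRateAtCritical d f_ω` — the converse of R4.b in the
# lane's typed vocabulary (rate at `p_c` ⟺ modulus at `p_c⁺`, every `d ≥ 3`)

builds on p205010 (kernel theorem, internal audit signed; external expert review pending).
Status sentence for p205010: "θ(p_c) = 0 on ℤ^d, all d ≥ 2 — kernel-verified (Lean 4/Mathlib, standard
axioms); internal adversarial audit SIGNED 2026-08-20 04:29Z; external expert review pending."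

Seat `prim-quant-arm-3` (gen 3), `--supports stmt-CriticalPhenomena-4575`; pure proofs, no definitions.
The lane's R4.b is `ThetaModulus.thetaModulusNearCritical_of_oneArmRate : OneArmRateAtCritical d f → ThetaModulusNearCritical d ω_f`
(an explicit one-arm rate at `p_c` gives an explicit modulus of continuity of `θ` at `p_c⁺`).  From the uniform
Duminil-Copin–Kozma–Tassion bound of `…QuantOneArmOfThetaDKT` (`Quant.oneArm_criticalProbI_le_theta_sqrt_log`:
`π_{p_c}(n) ≤ θ(p_c + √(2C/log n)) + |HOct d| e^{−√n}`) this file proves the CONVERSE in the same vocabulary: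

* `Quant.oneArmRateAtCritical_of_thetaModulusNearCritical` — for `d ≥ 3` and any modulus `ω` with `ThetaModulusNearCritical d ω`,
  `OneArmRateAtCritical d f_ω` holds with the explicit rate `f_ω(n) = ω(√(2C/log n)) + |HOct d| e^{−√n}` at the `n ≥ 2` with
  `√(2C/log n) ≤ (1 − p_c)/2`, and `f_ω(n) = 1` at the (finitely many) other `n`; `f_ω → 0` because `ω(t) → 0` as `t → 0⁺`.

So, unconditionally and in every `d ≥ 3`, the lane's two target SHAPES (R0.b: a one-arm rate at `p_c`; R0.c: a modulus for `θ` at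
`p_c⁺`) are EQUIVALENT data: each instance of one produces an explicit instance of the other (R4.b and this file).  Nothing here is
a rate: composing the two directions only degrades a given rate/modulus (`n ↦ √(C/log n)`, `t ↦ n(t)`).  `C = C(d)` is DKT's constant.
[cite: DuminilcopinKozmaTassion2020, Theorem 2 (p > p_c)]
-/

noncomputable section

namespace Summit.CriticalPhenomena.PercolationContinuityZ3.Theorems.Quant

open MeasureTheory Filter Topology Literature.Probability.Percolation Literature.Probability.LatticeModels
open scoped Classical

variable {d : ℕ}

/-- `√(2C/log n) → 0` along `ℕ`. [folklore] -/
theorem tendsto_sqrt_div_log_nat (C : ℝ) :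
    Tendsto (fun n : ℕ => Real.sqrt (2 * C / Real.log n)) atTop (𝓝 0) := by
  have hlog : Tendsto (fun n : ℕ => Real.log n) atTop atTop :=
    Real.tendsto_log_atTop.comp tendsto_natCast_atTop_atTop
  have hdiv : Tendsto (fun n : ℕ => 2 * C / Real.log n) atTop (𝓝 0) := tendsto_const_nhds.div_atTop hlog
  have hsqrt := (Real.continuous_sqrt.tendsto 0).comp hdiv
  rwa [Function.comp_def, Real.sqrt_zero] at hsqrt

/-- `e^{−√n} → 0` along `ℕ`. [folklore] -/
theorem tendsto_exp_neg_sqrt_nat : Tendsto (fun n : ℕ => Real.exp (-Real.sqrt n)) atTop (𝓝 0) := by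
  have h1 : Tendsto (fun n : ℕ => Real.sqrt n) atTop atTop :=
    Real.tendsto_sqrt_atTop.comp tendsto_natCast_atTop_atTop
  exact Real.tendsto_exp_neg_atTop_nhds_zero.comp h1

/-- **`ThetaModulusNearCritical d ω ⇒ OneArmRateAtCritical d f_ω`** (`d ≥ 3`, unconditional; the converse of R4.b
`ThetaModulus.thetaModulusNearCritical_of_oneArmRate`): with DKT's constant `C = C(d) > 0` of
`Quant.oneArm_criticalProbI_le_theta_sqrt_log`, the function
`f_ω(n) = ω(√(2C/log n)) + |HOct d| e^{−√n}` if `n ≥ 2` and `√(2C/log n) ≤ (1−p_c)/2`, and `f_ω(n) = 1` otherwise,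
is a one-arm rate at `p_c`: `f_ω → 0` and `π_{p_c}(n) ≤ f_ω(n)` for all `n ≥ 1`.  Hence at `p_c` an explicit one-arm rate and an
explicit modulus of continuity of `θ` are equivalent data in every `d ≥ 3`.  New; mechanism DKT 2020 Thm. 2 (quantitative
Grimmett–Marstrand) + the decomposition `π_{p_c} ≤ θ(p) + P_p(0 ↔ ∂Λ_n, 0 ↮ ∞)`.
builds on p205010 (kernel theorem, internal audit signed; external expert review pending) (not used).
[cite: DuminilcopinKozmaTassion2020, Theorem 2 (p > p_c)] -/
theorem oneArmRateAtCritical_of_thetaModulusNearCritical (hd : 3 ≤ d) {ω : ℝ → ℝ} (hω : ThetaModulusNearCritical d ω) :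
    ∃ C : ℝ, 0 < C ∧ OneArmRateAtCritical d (fun n : ℕ =>
      if 2 ≤ n ∧ Real.sqrt (2 * C / Real.log n) ≤ (1 - (criticalProbI d : ℝ)) / 2 then
        ω (Real.sqrt (2 * C / Real.log n)) + Fintype.card (GM.HOct d) * Real.exp (-Real.sqrt n)
      else 1) := by
  have hd2 : 2 ≤ d := by omega
  obtain ⟨C, hC, h⟩ := oneArm_criticalProbI_le_theta_sqrt_log hd
  obtain ⟨hωlim, hωle⟩ := hω
  set pc : ℝ := (criticalProbI d : ℝ) with hpcdef
  have hpc1 : pc < 1 := by rw [hpcdef, coe_criticalProbI]; exact criticalProb_zd_lt_one hd2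
  set δ : ℕ → ℝ := fun n => Real.sqrt (2 * C / Real.log n) with hδ
  set κ : ℝ := (Fintype.card (GM.HOct d) : ℝ) with hκ
  refine ⟨C, hC, ?_, ?_⟩
  · -- `f_ω → 0`
    have hδ0 : Tendsto δ atTop (𝓝 0) := tendsto_sqrt_div_log_nat C
    have hδw : Tendsto δ atTop (𝓝[Set.Ici 0] 0) :=
      tendsto_nhdsWithin_iff.2 ⟨hδ0, Eventually.of_forall fun n => Real.sqrt_nonneg _⟩
    have hωδ : Tendsto (fun n => ω (δ n)) atTop (𝓝 0) := hωlim.comp hδw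
    have hsum : Tendsto (fun n : ℕ => ω (δ n) + κ * Real.exp (-Real.sqrt n)) atTop (𝓝 0) := by
      have := hωδ.add (tendsto_exp_neg_sqrt_nat.const_mul κ)
      simpa using this
    -- eventually the condition holds
    have hev : ∀ᶠ n : ℕ in atTop, 2 ≤ n ∧ δ n ≤ (1 - pc) / 2 := by
      have h1 : ∀ᶠ n : ℕ in atTop, δ n ≤ (1 - pc) / 2 :=
        (hδ0.eventually (eventually_le_nhds (by linarith : (0 : ℝ) < (1 - pc) / 2)))
      exact (eventually_ge_atTop 2).and h1
    refine hsum.congr' ?_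
    filter_upwards [hev] with n hn
    rw [if_pos hn]
  · -- `π_{p_c}(n) ≤ f_ω(n)`
    intro n hn
    dsimp only
    by_cases hcond : 2 ≤ n ∧ Real.sqrt (2 * C / Real.log n) ≤ (1 - pc) / 2
    · rw [if_pos hcond]
      obtain ⟨hn2, hδle⟩ := hcond
      have hδnn : 0 ≤ δ n := Real.sqrt_nonneg _
      have hδle' : δ n ≤ (1 - pc) / 2 := hδle
      have hqI : pc + δ n ∈ unitInterval := ⟨by linarith [(criticalProbI d).2.1], by linarith⟩
      set q : unitInterval := ⟨pc + δ n, hqI⟩ with hq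
      have hqcoe : (q : ℝ) = pc + δ n := rfl
      have h1 := h n hn2 q (by rw [hqcoe]) (by rw [hqcoe]; linarith)
      have hqge : criticalProbI d ≤ q := by rw [← Subtype.coe_le_coe, hqcoe]; linarith
      have hθ := hωle q hqge
      rw [show (q : ℝ) - criticalProbI d = δ n by rw [hqcoe]; ring] at hθ
      calc oneArmProb d (criticalProbI d) n ≤ theta (zdGraph d) 0 q + κ * Real.exp (-Real.sqrt n) := h1
        _ ≤ ω (δ n) + κ * Real.exp (-Real.sqrt n) := add_le_add hθ le_rfl
    · rw [if_neg hcond]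
      unfold oneArmProb; exact measureReal_le_one

end Summit.CriticalPhenomena.PercolationContinuityZ3.Theorems.Quant

end
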